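import Summits.ValiantsHypothesis.ValiantsHypothesis.Theorems.DivisionGapPerDivisionHardStubAtomicTop

/-!
# Crux `DivisionGap.PerDivisionHard` (stmt-ValiantsHypothesis-5065), line `pair-descent-jss-endpoint` —
stub `stub_sigmaPiSigmaPiCount`: the top fibre of a `ΣΠΣΠ` expression over a decided atom pool

A `ΣΠΣΠ` EXPRESSION over a common atom pool `F : ι → ℝ≥0[x_ij]` is
`h = Σ_{l ∈ L} a_l · x^{C_l} · ∏_{γ ∈ J} P_γ^{ν_l(γ)}` with inner atomic expressions
`P_γ = Σ_{l' ∈ L'_γ} a'_{γ,l'} · x^{C'_{γ,l'}} · ∏_{β ∈ I} F_β^{μ_γ(l',β)}`.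
`stub_sigmaPiSigmaPiCount`: if every atom `F_β` is DECIDED by the weight `w` (its top-`w` fibre has
at most one monomial), the top-`w` fibre of `h` has at most `Σ_{l ∈ L} ∏_{γ ∈ J} |L'_γ|^{ν_l(γ)}`
monomials.

Proof.  `h` is itself an atomic expression with atoms `P_γ`, so (`stub_atomicTop`) a fibre
monomial is `m = C_l + Σ_{γ ∈ J} Σ_{j < ν_l(γ)} p_{γ,j}` for one term `l ∈ L` with every `p_{γ,j}`
in the top fibre of `P_γ`; by `stub_atomicTop` again and decidedness (all atom-fibre monomials of
`F_β` equal one representative `t_β`), every top monomial of `P_γ` is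
`g_γ(l') = C'_{γ,l'} + Σ_β μ_γ(l',β) • t_β` for some `l' ∈ L'_γ`.  Hence the fibre lies in
`⋃_l (C_l + Σ_γ Σ_{j < ν_l(γ)} g_γ(L'_γ))` (pointwise finset sums), whose cardinality is at most
`Σ_l ∏_γ |L'_γ|^{ν_l(γ)}` (`Finset.card_biUnion_le`, `Finset.card_image_le`, `Finset.card_add_le`
iterated). [folklore]
-/

noncomputable section

-- `Summit.ValiantsHypothesis.ValiantsHypothesis.…` is the tree's mandated single-conjunct layout
-- (Sub = Summit), so the duplicated namespace component is intended.
set_option linter.dupNamespace false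

namespace Summit.ValiantsHypothesis.ValiantsHypothesis.Theorems.DivisionGapPerDivisionHard

open MvPolynomial Literature.Computability.AlgebraicComplexity
open Summit.ValiantsHypothesis.ValiantsHypothesis.Theorems.ZeroOneTransfer.Negative
open scoped NNReal Pointwise

/-! ### Pointwise finset sums: membership and cardinality -/

/-- An `n`-ary `Finset.add_mem_add`: a sum of elements of finsets lies in the pointwise sum of the
finsets. [folklore] -/
theorem sum_mem_finset_sum {M α : Type*} [AddCommMonoid M] [DecidableEq M] (s : Finset α)
    (T : α → Finset M) (x : α → M) (hx : ∀ i ∈ s, x i ∈ T i) :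
    ∑ i ∈ s, x i ∈ ∑ i ∈ s, T i := by
  classical
  induction s using Finset.induction_on with
  | empty => simp
  | insert a s ha ih =>
    rw [Finset.sum_insert ha, Finset.sum_insert ha]
    exact Finset.add_mem_add (hx a (Finset.mem_insert_self a s))
      (ih fun i hi => hx i (Finset.mem_insert_of_mem hi))

/-- An `n`-ary `Finset.card_add_le`: the pointwise sum of finsets of cardinalities `≤ b i` has
cardinality `≤ ∏ b i`. [folklore] -/
theorem card_finset_sum_le {M α : Type*} [AddCommMonoid M] [DecidableEq M] (s : Finset α)
    (T : α → Finset M) (b : α → ℕ) (hb : ∀ i ∈ s, (T i).card ≤ b i) :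
    (∑ i ∈ s, T i).card ≤ ∏ i ∈ s, b i := by
  classical
  induction s using Finset.induction_on with
  | empty => simp
  | insert a s ha ih =>
    rw [Finset.sum_insert ha, Finset.prod_insert ha]
    exact Finset.card_add_le.trans (Nat.mul_le_mul (hb a (Finset.mem_insert_self a s))
      (ih fun i hi => hb i (Finset.mem_insert_of_mem hi)))

/-! ### The stub -/

/-- **`stub_sigmaPiSigmaPiCount`.**  If every atom `F_β`, `β ∈ I`, is DECIDED by `w` (its top-`w`
fibre has at most one monomial), then the top-`w` fibre of the `ΣΠΣΠ` expression
`Σ_{l ∈ L} a_l x^{C_l} ∏_{γ ∈ J} (Σ_{l' ∈ L'_γ} a'_{γ,l'} x^{C'_{γ,l'}} ∏_{β ∈ I} F_β^{μ_γ(l',β)})^{ν_l(γ)}`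
has at most `Σ_l ∏_γ |L'_γ|^{ν_l(γ)}` monomials: every fibre monomial is determined by a term
`l ∈ L` and a choice of an inner term `l' ∈ L'_γ` for each `γ ∈ J` and each of the `ν_l(γ)`
factors `P_γ` (`stub_atomicTop` twice, then decidedness; `Finset.card_biUnion_le`,
`Finset.card_image_le`, `Finset.card_add_le`). [folklore] -/
theorem stub_sigmaPiSigmaPiCount :
    ∀ (n : ℕ) (ι κ κ' θ : Type) (I : Finset ι) (L : Finset κ) (J : Finset θ) (L' : θ → Finset κ')
      (F : ι → MvPolynomial (Fin n × Fin n) ℝ≥0) (a : κ → ℝ≥0) (C : κ → (Fin n × Fin n) →₀ ℕ)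
      (a' : θ → κ' → ℝ≥0) (C' : θ → κ' → (Fin n × Fin n) →₀ ℕ) (μ : θ → κ' → ι → ℕ)
      (ν : κ → θ → ℕ) (w : Fin n × Fin n → ℕ),
      (∀ β ∈ I, ∀ f ∈ (topComponent w (F β)).support,
        ∀ f' ∈ (topComponent w (F β)).support, f = f') →
      (topComponent w (∑ l ∈ L, a l • (monomial (C l) (1 : ℝ≥0) *
        ∏ γ ∈ J, (∑ l' ∈ L' γ, a' γ l' • (monomial (C' γ l') (1 : ℝ≥0) *
          ∏ β ∈ I, F β ^ μ γ l' β)) ^ ν l γ))).support.card ≤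
        ∑ l ∈ L, ∏ γ ∈ J, (L' γ).card ^ ν l γ := by
  intro n ι κ κ' θ I L J L' F a C a' C' μ ν w hdec
  classical
  -- a representative of each (at most one-element) atom fibre
  have ht' : ∀ β, ∃ tβ : (Fin n × Fin n) →₀ ℕ,
      β ∈ I → ∀ f ∈ (topComponent w (F β)).support, f = tβ := by
    intro β
    by_cases hne : (topComponent w (F β)).support.Nonempty
    · obtain ⟨f₀, hf₀⟩ := hne
      exact ⟨f₀, fun hβ f hf => hdec β hβ f hf f₀ hf₀⟩
    · exact ⟨0, fun _ f hf => absurd ⟨f, hf⟩ hne⟩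
  choose t ht using ht'
  -- the candidate monomials `g γ l' = C'_{γ,l'} + Σ_β μ_γ(l',β) • t_β` of the inner fibres
  obtain ⟨g, hg⟩ : ∃ g : θ → κ' → (Fin n × Fin n) →₀ ℕ,
      ∀ γ l', g γ l' = C' γ l' + ∑ β ∈ I, μ γ l' β • t β := ⟨_, fun _ _ => rfl⟩
  -- every top monomial of the inner atomic expression `P γ` is some `g γ l'`, `l' ∈ L' γ`
  have hinner : ∀ (γ : θ) (p : (Fin n × Fin n) →₀ ℕ),
      p ∈ (topComponent w (∑ l' ∈ L' γ, a' γ l' • (monomial (C' γ l') (1 : ℝ≥0) *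
        ∏ β ∈ I, F β ^ μ γ l' β))).support → p ∈ (L' γ).image (g γ) := by
    intro γ p hp
    obtain ⟨l', hl', f', hf', rfl⟩ :=
      stub_atomicTop n ι κ' I (L' γ) F (a' γ) (C' γ) (μ γ) w p hp
    refine Finset.mem_image.2 ⟨l', hl', ?_⟩
    rw [hg]
    congr 1
    refine Finset.sum_congr rfl fun β hβ => ?_
    rw [Finset.sum_congr rfl fun j hj => ht β hβ _ (hf' β hβ j (Finset.mem_range.mp hj)),
      Finset.sum_const, Finset.card_range]
  -- the outer decomposition: the fibre lies in `⋃_l (C_l + Σ_γ Σ_{j < ν_l γ} g γ (L' γ))`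
  have hsub : (topComponent w (∑ l ∈ L, a l • (monomial (C l) (1 : ℝ≥0) *
        ∏ γ ∈ J, (∑ l' ∈ L' γ, a' γ l' • (monomial (C' γ l') (1 : ℝ≥0) *
          ∏ β ∈ I, F β ^ μ γ l' β)) ^ ν l γ))).support ⊆
      L.biUnion fun l => (∑ γ ∈ J, ∑ j ∈ Finset.range (ν l γ), (L' γ).image (g γ)).image
        fun x => C l + x := by
    intro m hm
    obtain ⟨l, hl, f, hf, rfl⟩ := stub_atomicTop n θ κ J L
      (fun γ => ∑ l' ∈ L' γ, a' γ l' • (monomial (C' γ l') (1 : ℝ≥0) *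
        ∏ β ∈ I, F β ^ μ γ l' β)) a C ν w m hm
    refine Finset.mem_biUnion.2 ⟨l, hl, Finset.mem_image.2
      ⟨∑ γ ∈ J, ∑ j ∈ Finset.range (ν l γ), f γ j, ?_, rfl⟩⟩
    exact sum_mem_finset_sum J _ _ fun γ hγ =>
      sum_mem_finset_sum (Finset.range (ν l γ)) _ _ fun j hj =>
        hinner γ _ (hf γ hγ j (Finset.mem_range.mp hj))
  calc (topComponent w (∑ l ∈ L, a l • (monomial (C l) (1 : ℝ≥0) *
        ∏ γ ∈ J, (∑ l' ∈ L' γ, a' γ l' • (monomial (C' γ l') (1 : ℝ≥0) *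
          ∏ β ∈ I, F β ^ μ γ l' β)) ^ ν l γ))).support.card
      ≤ (L.biUnion fun l => (∑ γ ∈ J, ∑ j ∈ Finset.range (ν l γ), (L' γ).image (g γ)).image
          fun x => C l + x).card := Finset.card_le_card hsub
    _ ≤ ∑ l ∈ L, ((∑ γ ∈ J, ∑ j ∈ Finset.range (ν l γ), (L' γ).image (g γ)).image
          fun x => C l + x).card := Finset.card_biUnion_le
    _ ≤ ∑ l ∈ L, ∏ γ ∈ J, (L' γ).card ^ ν l γ := by
      refine Finset.sum_le_sum fun l _ => Finset.card_image_le.trans ?_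
      refine card_finset_sum_le J _ _ fun γ _ => ?_
      exact (card_finset_sum_le (Finset.range (ν l γ)) _ (fun _ => (L' γ).card)
        fun _ _ => Finset.card_image_le).trans_eq
          (by rw [Finset.prod_const, Finset.card_range])

end Summit.ValiantsHypothesis.ValiantsHypothesis.Theorems.DivisionGapPerDivisionHard

end
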